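import Summits.QuantumFields.YangMills.Theorems.PencilRigidityDiagonalMirrorRPRSignDichotomy

/-!
# Crux `DiagonalMirrorRPR` (stmt-QuantumFields-10604), line `centre-twisted-swap` — lead c8's skeleton of record
# (reshape of c3/c7's residual by the SIGN DICHOTOMY: each of the three registered statements weakened)

Routes `PencilRigidity` (#5) = `MirrorModularBoosts` (#4) = `IsotropyFromPowerCounting` (#5) of `YangMills`, shared verbatim.
Everything provable of the line is LANDED (S1' p111074, S4'' p131739, compositions p117149 / p133632, and the sign dichotomy
`Theorems/…SignDichotomy`: `CurvaturePackage` is stable under re-indexing the scheme along any strictly monotone `φ` while the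
conclusion does not mention the scheme, so WLOG the couplings have one sign at EVERY step).  The residual of the crux AS TYPED is
therefore exactly:

* T⁺   `stub_transportNonnegCouplings`   — cover transport at physical scale, couplings `0 ≤ β_k` at every step;
* T_c⁻ `stub_transportCentreNegCouplings` — cover transport for centre data (`-𝟙 ∈ ρ(Z(G))`), couplings `β_k < 0` at every step;
* N⁻   `stub_scopeCentreBlindNegCouplings` — the crux itself for centre-blind data with `β_k < 0` at every step (scope statement:
  Wilson's weight has no diagonal Schur cut on ANY volume there; vacuous once `sch.HasWeakCouplingLimit` is threaded into `W₁`).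

Each is implied by the corresponding registered stub of c3/c7 (`SignDichotomy.reshaped_of_registered_T/_Tc/_N`).  None is a
consequence of `W₁ = CurvaturePackage r sch S₁`: its only lattice-side clauses are `hconv` (the scheme's own odd tori) and
`HasLatticeMassGap` (per-pair clustering on larger odd CUBIC tori; at fixed `k` it upgrades to a uniform spectral gap of every
cubic-torus limit state `ω_k`, but T⁺ still needs (Q1) `ω_k` swap-RP = shape-independence of the infinite-volume state at coupling
`β_k` and (Q2) torus-to-`ω_k` insensitivity of the RENORMALISED strings at physical scale, finite-size corrections `o(c_k^{-n})` —
neither is a clause of `W₁`; see `Cruxes/DiagonalMirrorRPR/PICKED.md` (c8) and `Lines/centre-twisted-swap-dead.md`).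
-/

set_option autoImplicit false

noncomputable section

open scoped SchwartzMap
open MeasureTheory Filter Topology
open Literature.MathematicalPhysics.QuantumLattice Literature.MathematicalPhysics.AQFT
  Literature.MathematicalPhysics.QuantumFieldTheory

namespace Summit.QuantumFields.YangMills.Cruxes.DiagonalMirrorRPR.CentreTwistedSwap

open ParityBridgeColdTraces

/-- **T⁺ (`stub_transportNonnegCouplings`).**  With couplings non-negative at EVERY step, the renormalised curvature strings on the
scheme's odd torus `ℤ⁴/(2L_k+1)ℤ⁴` and on its 45° double cover `T̃_{2L_k+1}` have the same limit on compactly supported real families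
with pairwise disjoint supports (`CoverInsensitivityOffDiag`).  Finite-size / shape insensitivity of 4D Wilson lattice gauge theory
at PHYSICAL scale along an arbitrary gapped scheme — not a consequence of `W₁`. -/
theorem stub_transportNonnegCouplings :
    ∀ (G : Type) [Group G] [TopologicalSpace G] [IsTopologicalGroup G] [CompactSpace G]
      [MeasurableSpace G] [BorelSpace G], IsCompactSimpleLieGroup G →
      ∀ (r : LatticeRep G) (sch : SpeciesScheme (YMSpecies G)) (S₁ : SchwingerFamily E4),
        CurvaturePackage r sch S₁ → (∀ k, 0 ≤ sch.β k) → CoverInsensitivityOffDiag r sch := by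
  sorry

/-- **T_c⁻ (`stub_transportCentreNegCouplings`).**  The same cover transport for centre data `r.ρ z = -𝟙`, `z ∈ Z(G)`, with
couplings NEGATIVE at every step (odd torus = coupling `|β_k|` with the maximal 't Hooft twist, cover = `|β_k|` with one twist:
twist-insensitivity of local correlators at physical scale).  Not a consequence of `W₁`. -/
theorem stub_transportCentreNegCouplings :
    ∀ (G : Type) [Group G] [TopologicalSpace G] [IsTopologicalGroup G] [CompactSpace G]
      [MeasurableSpace G] [BorelSpace G], IsCompactSimpleLieGroup G →
      ∀ (r : LatticeRep G) (sch : SpeciesScheme (YMSpecies G)) (S₁ : SchwingerFamily E4),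
        CurvaturePackage r sch S₁ → (∃ z ∈ Subgroup.center G, r.ρ z = -1) → (∀ k, sch.β k < 0) →
          CoverInsensitivityOffDiag r sch := by
  sorry

/-- **N⁻ (`stub_scopeCentreBlindNegCouplings`, scope statement).**  The crux itself restricted to centre-blind data
(`-𝟙 ∉ ρ(Z(G))`) and schemes with `β_k < 0` at EVERY step — no diagonal Schur cut of Wilson's weight on any volume (Disproof §5(a));
leverless; vacuous once `W₁` carries `∀ᶠ k, 0 ≤ β_k` or the Statement's `sch.HasWeakCouplingLimit`. -/
theorem stub_scopeCentreBlindNegCouplings :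
    ∀ (G : Type) [Group G] [TopologicalSpace G] [IsTopologicalGroup G] [CompactSpace G]
      [MeasurableSpace G] [BorelSpace G], IsCompactSimpleLieGroup G →
      ∀ (r : LatticeRep G) (sch : SpeciesScheme (YMSpecies G)) (S₁ : SchwingerFamily E4),
        CurvaturePackage r sch S₁ → (¬ ∃ z ∈ Subgroup.center G, r.ρ z = -1) → (∀ k, sch.β k < 0) →
          DiagonalFrameRP S₁ := by
  sorry

/-- **Composition (`PencilRigidity` copy, by name)**: the landed sign-dichotomy composition
`SignDichotomy.DiagonalMirrorRPR_of_signedTransport` applied to the three residual stubs. -/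
theorem DiagonalMirrorRPR_of : Summit.QuantumFields.YangMills.Theses.PencilRigidity.DiagonalMirrorRPR :=
  SignDichotomy.DiagonalMirrorRPR_of_signedTransport stub_transportNonnegCouplings stub_transportCentreNegCouplings
    stub_scopeCentreBlindNegCouplings

/-- **Composition (the item's recorded decl, `MirrorModularBoosts` copy, by name).** -/
theorem DiagonalMirrorRPR_proof : Summit.QuantumFields.YangMills.Theses.MirrorModularBoosts.DiagonalMirrorRPR :=
  SignDichotomy.DiagonalMirrorRPR_mmb_of_signedTransport stub_transportNonnegCouplings stub_transportCentreNegCouplings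
    stub_scopeCentreBlindNegCouplings

/-- **Composition (`IsotropyFromPowerCounting` copy, by name).** -/
theorem DiagonalMirrorRPR_of_isotropy :
    Summit.QuantumFields.YangMills.Theses.IsotropyFromPowerCounting.DiagonalMirrorRPR :=
  SignDichotomy.DiagonalMirrorRPR_isotropy_of_signedTransport stub_transportNonnegCouplings
    stub_transportCentreNegCouplings stub_scopeCentreBlindNegCouplings

end Summit.QuantumFields.YangMills.Cruxes.DiagonalMirrorRPR.CentreTwistedSwap

end
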